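/-
Copyright (c) 2026 the pub-hodgecm-mathlib formalisation cell (harness21).  Prover fan seat hodgecm-mathlib-LH7-p05 (g3) (F0 ∕ P3c ∕ LH7, lent to
Track B «K2-LIT»), hLiu418 = `stmt-HodgeConjecture-24832`; K1a DESK WORD #18 (2) (K2Liu-p01 (g11)) deal (α).  THEOREMS ONLY (no `def`, no instance, no notation,
no named-fact hypothesis, no `sorry`); lane `--supports stmt-HodgeConjecture-24832 --as helper`.
-/
import Summits.HodgeConjecture.HodgeConjecture.Theorems.K2LiuArchTwistedScalarLettersGrowthNeg    -- ★ p864948 ⊇ ★ p864912: the datum-uniform explicit letters (±)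
import Summits.HodgeConjecture.HodgeConjecture.Theorems.K2LiuKindOneSingularCornerIndexDatum      -- ★ p864832: the corner datum vocabulary (`Sk`, `HA`, frames)
import HarnessLib

/-!
# Crux `HLiu418`, socket #41, KIND 1 a♮ — (α) `K2LiuKindOneSingularArchLettersOfRecord`: THE PER-PLACE ARCH ALPHABET `Acw hAcw hAw hP1 hAcwb` of ★ p864498
# `hAcb_of_archLetters`, produced from the scalar-type explicit letters ★ p864912 ∕ ★ p864948 at the corner datum of ★ p864832

Cell `hodgecm-mathlib`, hLiu418 = `stmt-HodgeConjecture-24832` (helper lane, count-neutral); squad K2 ∕ K2Liu, road `K2_Liu`, KIND 1 a♮; K1a desk K2Liu-p01 (g11).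
CONSUMER: the D-1 tie of ★ p864498 `K2LiuKindOneSingularArchDecayOfRecord.hAcb_of_archLetters` (slots `Acw hAcw hAw` :89–:96, (iv) `hP1 hAcwb` :114–:119) at `n = 2`, with the
desk's CONSISTENCY BOOKING (WORD #18): `Pw X h w := ((1 + pw X h w)(1 + (pw X h w)⁻¹))·((1 + tw X w)(1 + (tw X w)⁻¹))·(1 + Rw X h w)`, `gw X h w := tw X w · pw X h w`, `cg := π`.
INPUTS BY VALUE: the faces `I` (finite face type `φ`), the places `Tinf`; the corner frame `a` (`‖det a‖ = 1`, ★ p864832); the corner translate `gc` and a tube frame `Fr`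
landing in `U(J)` (`hFrU`); the Gaussian variable `tw > 0`, the Gaussian parameter `pw` READ as ★ p864004's exponent at the translate (`hpw_eq`, LH4-p17's
`CornerTranslateReading` bytes) and an entry bound `Rw` of the frame (`hRw`); the scalar `K_∞`-types `k i w'` with a depth `Nd > |k|∕2`; a SIGN SPLIT `sgn` with the two
readings of the local block `Aloc` as the twisted integral of ★ p864912 (ii) (index `a·diag(tw,0)·aᴴ`) resp. ★ p864948 (ii) (index `−a·diag(tw,0)·aᴴ`).
OUTPUT: `∃ Acw, hAcw ∧ hAw ∧ hP1 ∧ hAcwb ∧ hZp ∧ hZn` — `Acw X i w s h := Ac^{±}_{k i w}(a, tw X w, s, Fr((gc X·h)_∞)_w)` by the sign; (iv)'s constants are made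
uniform over the finitely many `(i, w)` (`Mg := Σ sup`, `Cg := Σ`, `rg := (1 + Σ r⁻¹)⁻¹`); `hZp hZn` (appended) are the sign-letter zeros of ★ p864004 §2∕§4 (D-3 food).
* §1 `gaussParam_pos` (`0 < Re (aᴴ(2·Im(g·i1))a)₀₀` for `g ∈ U(J)`, `‖det a‖ = 1`); §2 **`archLetters_of_scalarTypeGrowth`**.
[Shimura1982, §4 Thm. 4.2, (4.34.K)], [Shimura1997, §18.4–18.5], [KudlaRallis1994, §2 (2.10)–(2.12)], [GanQiuTakeda2014, §6.4].
HONEST LABEL.  Re-packaging, count-neutral; closes no socket: `HC_CM` is proved only modulo the 7 printed citations (2 remaining named inputs: hLiu418 =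
`stmt-HodgeConjecture-24832`, h413 = `stmt-HodgeConjecture-24833`) until rung 0 closes.
-/

set_option autoImplicit false
set_option linter.dupNamespace false -- the mandated namespace repeats `HodgeConjecture.HodgeConjecture`

noncomputable section

open scoped Matrix ComplexConjugate ComplexOrder
open Complex Matrix NumberField NumberField.InfinitePlace IsDedekindDomain MeasureTheory
open Literature.NumberTheory.ModularForms.SiegelUpperHalfSpace (moeb)
open Literature.NumberTheory.Automorphic Literature.NumberTheory.Automorphic.UnitaryGroup Literature.NumberTheory.GaloisRepresentations
open Literature.NumberTheory.GelbartRogawski1991 Literature.NumberTheory.GelbartRogawski1991.GRConstruction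

namespace Summit.HodgeConjecture.HodgeConjecture.Cruxes.HLiu418.K2LiuKindOneSingularArchLettersOfRecord

open K2LiuSiegelUnipotentFourierDefs
open K2LiuHermTwoGammaDefs (hermTwo hermTwo_eq_of_isHermitian posDef_hermTwo_iff)
open K2LiuHermitianTubeCocycle (posDef_im_moeb posDef_im_I_smul_one)
open K2LiuArchInducedTubeDefs (hermOfReal archScalarSection)
open K2LiuHermTwoEtaRankOneWitnessGrowth (one_le_envFactor)
open K2LiuArchTwistedScalarLettersGrowthPi (exists_archLetters_scalarType_explicit_growth)
open K2LiuArchTwistedScalarLettersGrowthNeg (exists_archLetters_scalarType_explicit_neg_growth)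

/-! ## §1 The Gaussian parameter is positive -/

/-- **`0 < p(a, g) = Re (aᴴ(2·Im(g·i1))a)₀₀`** for `g ∈ U(J)` and `‖det a‖ = 1` (`Im(g·i1) ≻ 0` by ★ `posDef_im_moeb`, conjugation by the unit `a`, Sylvester on the `(0,0)`
entry). [cite: Shimura1997, §6.3] -/
theorem gaussParam_pos {a : Matrix (Fin 2) (Fin 2) ℂ} (ha : ‖a.det‖ = 1) {g : Matrix (Fin 2 ⊕ Fin 2) (Fin 2 ⊕ Fin 2) ℂ}
    (hg : gᴴ * Matrix.J (Fin 2) ℂ * g = Matrix.J (Fin 2) ℂ) :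
    0 < ((aᴴ * ((2 : ℂ) • ((2 * I)⁻¹ • (moeb g (I • (1 : Matrix (Fin 2) (Fin 2) ℂ)) - (moeb g (I • (1 : Matrix (Fin 2) (Fin 2) ℂ)))ᴴ))) * a) 0 0).re := by
  set V : Matrix (Fin 2) (Fin 2) ℂ := ((2 * I)⁻¹ • (moeb g (I • (1 : Matrix (Fin 2) (Fin 2) ℂ)) - (moeb g (I • (1 : Matrix (Fin 2) (Fin 2) ℂ)))ᴴ)) with hV
  have ha0 : a.det ≠ 0 := fun h0 => by rw [h0, norm_zero] at ha; exact zero_ne_one ha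
  have haU : IsUnit a := (Matrix.isUnit_iff_isUnit_det a).mpr (Ne.isUnit ha0)
  have hVpos : V.PosDef := posDef_im_moeb hg posDef_im_I_smul_one
  have h2V : ((2 : ℂ) • V).PosDef := by
    have h2 := hVpos.smul (by norm_num : (0 : ℝ) < 2)
    rwa [show ((2 : ℝ) • V) = ((2 : ℂ) • V) by rw [← Complex.coe_smul]; norm_num] at h2
  have hg' : (aᴴ * ((2 : ℂ) • V) * a).PosDef := by
    have := Matrix.IsUnit.posDef_star_left_conjugate_iff (x := (2 : ℂ) • V) haU
    rw [Matrix.star_eq_conjTranspose] at this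
    exact this.mpr h2V
  have he := hermTwo_eq_of_isHermitian hg'.1
  have hg'' : (hermTwo ((((aᴴ * ((2 : ℂ) • V) * a) 0 0).re), ((aᴴ * ((2 : ℂ) • V) * a) 0 1), (((aᴴ * ((2 : ℂ) • V) * a) 1 1).re))).PosDef := by
    rw [he]; exact hg'
  exact ((posDef_hermTwo_iff _).mp hg'').1

/-! ## §2 The per-place arch alphabet of ★ p864498 from the scalar-type letters -/

variable (L : Type) [Field L] [NumberField L] [IsCMField L] {N M : ℕ} (e : Fin N × Fin M ≃ Fin 2)
  (dV : Fin N → L) (hdV : ∀ i, IsCMField.complexConj L (dV i) = dV i)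
  (dW : Fin M → L) (hdW : ∀ i, IsCMField.complexConj L (dW i) = dW i)


/-- **THE PER-PLACE ARCH ALPHABET PRODUCER.**  From the frame `a`, the translate `gc` and tube frame `Fr ∈ U(J)`, the letters `tw > 0`, `pw` (= ★ p864004's exponent at the
translate, `hpw_eq`), `Rw` (entry bound, `hRw`), the `K_∞`-types `k` at depth `Nd`, and the sign-split readings `hAlocp ∕ hAlocn` of the local block as the twisted integral
of ★ p864912 ∕ ★ p864948 (ii): the letters `Acw hAcw hAw hP1 hAcwb` of ★ p864498 `hAcb_of_archLetters` at `n = 2`, `Pw := (1+pw)(1+pw⁻¹)(1+tw)(1+tw⁻¹)(1+Rw)`,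
`gw := tw·pw`, `cg := π` — plus the sign-letter zeros `hZp hZn`. [cite: Shimura1982, §4 Thm. 4.2, (4.34.K)] [cite: Shimura1997, §18.4–18.5] [cite: KudlaRallis1994, §2 (2.10)–(2.12)] -/
theorem archLetters_of_scalarTypeGrowth {φ : Type*} [Fintype φ]
    (I : skewMatrices ((IsCMField.complexConj L : L ≃ₐ[Fp L] L) : L →+* L) ((gramR L e dV hdV dW hdW).map (algebraMap (Fp L) L)) → HA L e dV hdV dW hdW → Finset φ)
    (Tinf : Finset (InfinitePlace L))
    (a : Matrix (Fin 2) (Fin 2) ℂ) (ha : ‖a.det‖ = 1)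
    (gc : skewMatrices ((IsCMField.complexConj L : L ≃ₐ[Fp L] L) : L →+* L) ((gramR L e dV hdV dW hdW).map (algebraMap (Fp L) L)) → HA L e dV hdV dW hdW)
    (Fr : UnitaryGroup.arch (Fp L) L (IsCMField.complexConj L) (2 + 2) (hermD L e dV hdV dW hdW) → {w : InfinitePlace L // w.IsComplex} →
      Matrix (Fin 2 ⊕ Fin 2) (Fin 2 ⊕ Fin 2) ℂ)
    (hFrU : ∀ (x : UnitaryGroup.arch (Fp L) L (IsCMField.complexConj L) (2 + 2) (hermD L e dV hdV dW hdW)) (w : {w : InfinitePlace L // w.IsComplex}),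
      (Fr x w)ᴴ * Matrix.J (Fin 2) ℂ * Fr x w = Matrix.J (Fin 2) ℂ)
    (tw : skewMatrices ((IsCMField.complexConj L : L ≃ₐ[Fp L] L) : L →+* L) ((gramR L e dV hdV dW hdW).map (algebraMap (Fp L) L)) → InfinitePlace L → ℝ)
    (htw0 : ∀ X : skewMatrices ((IsCMField.complexConj L : L ≃ₐ[Fp L] L) : L →+* L) ((gramR L e dV hdV dW hdW).map (algebraMap (Fp L) L)),
      (X : Matrix (Fin 2) (Fin 2) L) ≠ 0 → (X : Matrix (Fin 2) (Fin 2) L).det = 0 → ∀ w' ∈ Tinf, 0 < tw X w')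
    (pw Rw : skewMatrices ((IsCMField.complexConj L : L ≃ₐ[Fp L] L) : L →+* L) ((gramR L e dV hdV dW hdW).map (algebraMap (Fp L) L)) → HA L e dV hdV dW hdW →
      InfinitePlace L → ℝ)
    (hpw_eq : ∀ (X : skewMatrices ((IsCMField.complexConj L : L ≃ₐ[Fp L] L) : L →+* L) ((gramR L e dV hdV dW hdW).map (algebraMap (Fp L) L)))
      (h : HA L e dV hdV dW hdW) (w' : InfinitePlace L),
      pw X h w' = ((aᴴ * ((2 : ℂ) • ((2 * Complex.I)⁻¹ •
        (moeb (Fr (UnitaryGroup.archPart (Fp L) L (IsCMField.complexConj L) (2 + 2) (hermD L e dV hdV dW hdW) (gc X * h)) ⟨w', IsTotallyComplex.isComplex w'⟩)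
            (Complex.I • (1 : Matrix (Fin 2) (Fin 2) ℂ)) -
          (moeb (Fr (UnitaryGroup.archPart (Fp L) L (IsCMField.complexConj L) (2 + 2) (hermD L e dV hdV dW hdW) (gc X * h)) ⟨w', IsTotallyComplex.isComplex w'⟩)
            (Complex.I • (1 : Matrix (Fin 2) (Fin 2) ℂ)))ᴴ))) * a) 0 0).re)
    (hRw : ∀ (X : skewMatrices ((IsCMField.complexConj L : L ≃ₐ[Fp L] L) : L →+* L) ((gramR L e dV hdV dW hdW).map (algebraMap (Fp L) L)))
      (h : HA L e dV hdV dW hdW), ∀ w' ∈ Tinf, ∀ i j,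
      ‖Fr (UnitaryGroup.archPart (Fp L) L (IsCMField.complexConj L) (2 + 2) (hermD L e dV hdV dW hdW) (gc X * h)) ⟨w', IsTotallyComplex.isComplex w'⟩ i j‖ ≤ Rw X h w')
    (k : φ → {w : InfinitePlace L // w.IsComplex} → ℤ) (Nd : ℕ)
    (hNp : ∀ i w, (k i w : ℝ) / 2 < Nd) (hNn : ∀ i w, -(k i w : ℝ) / 2 < Nd)
    (sgn : skewMatrices ((IsCMField.complexConj L : L ≃ₐ[Fp L] L) : L →+* L) ((gramR L e dV hdV dW hdW).map (algebraMap (Fp L) L)) → InfinitePlace L → Bool)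
    (Aloc : skewMatrices ((IsCMField.complexConj L : L ≃ₐ[Fp L] L) : L →+* L) ((gramR L e dV hdV dW hdW).map (algebraMap (Fp L) L)) → φ → InfinitePlace L → ℂ →
      HA L e dV hdV dW hdW → ℂ)
    (hAlocp : ∀ X : skewMatrices ((IsCMField.complexConj L : L ≃ₐ[Fp L] L) : L →+* L) ((gramR L e dV hdV dW hdW).map (algebraMap (Fp L) L)),
      (X : Matrix (Fin 2) (Fin 2) L) ≠ 0 → (X : Matrix (Fin 2) (Fin 2) L).det = 0 → ∀ (h : HA L e dV hdV dW hdW), ∀ i ∈ I X h, ∀ w' ∈ Tinf, sgn X w' = true →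
      ∀ s : ℂ, 1 / 2 < s.re → Aloc X i w' s h =
        ∫ r : Fin 2 → Fin 2 → ℝ, cexp (-(2 * Real.pi * Complex.I) * ((a * hermTwo (tw X w', 0, 0) * aᴴ) * hermOfReal r).trace) *
          archScalarSection (k i ⟨w', IsTotallyComplex.isComplex w'⟩) s (Matrix.J (Fin 2) ℂ * fromBlocks 1 (hermOfReal r) 0 1 *
            Fr (UnitaryGroup.archPart (Fp L) L (IsCMField.complexConj L) (2 + 2) (hermD L e dV hdV dW hdW) (gc X * h)) ⟨w', IsTotallyComplex.isComplex w'⟩))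
    (hAlocn : ∀ X : skewMatrices ((IsCMField.complexConj L : L ≃ₐ[Fp L] L) : L →+* L) ((gramR L e dV hdV dW hdW).map (algebraMap (Fp L) L)),
      (X : Matrix (Fin 2) (Fin 2) L) ≠ 0 → (X : Matrix (Fin 2) (Fin 2) L).det = 0 → ∀ (h : HA L e dV hdV dW hdW), ∀ i ∈ I X h, ∀ w' ∈ Tinf, sgn X w' = false →
      ∀ s : ℂ, 1 / 2 < s.re → Aloc X i w' s h =
        ∫ r : Fin 2 → Fin 2 → ℝ, cexp (-(2 * Real.pi * Complex.I) * ((-(a * hermTwo (tw X w', 0, 0) * aᴴ)) * hermOfReal r).trace) *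
          archScalarSection (k i ⟨w', IsTotallyComplex.isComplex w'⟩) s (Matrix.J (Fin 2) ℂ * fromBlocks 1 (hermOfReal r) 0 1 *
            Fr (UnitaryGroup.archPart (Fp L) L (IsCMField.complexConj L) (2 + 2) (hermD L e dV hdV dW hdW) (gc X * h)) ⟨w', IsTotallyComplex.isComplex w'⟩)) :
    ∃ Acw : skewMatrices ((IsCMField.complexConj L : L ≃ₐ[Fp L] L) : L →+* L) ((gramR L e dV hdV dW hdW).map (algebraMap (Fp L) L)) → φ → InfinitePlace L → ℂ →
        HA L e dV hdV dW hdW → ℂ,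
      -- `hAcw` (★ p864498 :91–:93)
      (∀ X : skewMatrices ((IsCMField.complexConj L : L ≃ₐ[Fp L] L) : L →+* L) ((gramR L e dV hdV dW hdW).map (algebraMap (Fp L) L)),
        (X : Matrix (Fin 2) (Fin 2) L) ≠ 0 → (X : Matrix (Fin 2) (Fin 2) L).det = 0 → ∀ (h : HA L e dV hdV dW hdW), ∀ i ∈ I X h, ∀ w ∈ Tinf,
          DifferentiableOn ℂ (fun s => Acw X i w s h) {s : ℂ | 0 < s.re}) ∧
      -- `hAw` (★ p864498 :94–:96)
      (∀ X : skewMatrices ((IsCMField.complexConj L : L ≃ₐ[Fp L] L) : L →+* L) ((gramR L e dV hdV dW hdW).map (algebraMap (Fp L) L)),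
        (X : Matrix (Fin 2) (Fin 2) L) ≠ 0 → (X : Matrix (Fin 2) (Fin 2) L).det = 0 → ∀ (h : HA L e dV hdV dW hdW), ∀ i ∈ I X h, ∀ w ∈ Tinf,
          ∀ s : ℂ, 1 / 2 < s.re → Aloc X i w s h = Acw X i w s h) ∧
      -- `hP1` (★ p864498 :114–:115) at the booked `Pw`
      (∀ (X : skewMatrices ((IsCMField.complexConj L : L ≃ₐ[Fp L] L) : L →+* L) ((gramR L e dV hdV dW hdW).map (algebraMap (Fp L) L))) (h : HA L e dV hdV dW hdW),
        (X : Matrix (Fin 2) (Fin 2) L) ≠ 0 → (X : Matrix (Fin 2) (Fin 2) L).det = 0 → ∀ w ∈ Tinf,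
          1 ≤ ((1 + pw X h w) * (1 + (pw X h w)⁻¹)) * ((1 + tw X w) * (1 + (tw X w)⁻¹)) * (1 + Rw X h w)) ∧
      -- `hAcwb` (★ p864498 :116–:119) at the booked `Pw`, `gw := tw·pw`
      (∀ z : ℂ, 0 < z.re → ∃ (Mg : ℕ) (Cg cg rg : ℝ), 0 ≤ Cg ∧ 0 < cg ∧ 0 < rg ∧
        ∀ (X : skewMatrices ((IsCMField.complexConj L : L ≃ₐ[Fp L] L) : L →+* L) ((gramR L e dV hdV dW hdW).map (algebraMap (Fp L) L))) (s : ℂ), dist s z < rg →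
        ∀ h : HA L e dV hdV dW hdW, (X : Matrix (Fin 2) (Fin 2) L) ≠ 0 → (X : Matrix (Fin 2) (Fin 2) L).det = 0 → ∀ i ∈ I X h, ∀ w ∈ Tinf,
          ‖Acw X i w s h‖ ≤ Cg * (((1 + pw X h w) * (1 + (pw X h w)⁻¹)) * ((1 + tw X w) * (1 + (tw X w)⁻¹)) * (1 + Rw X h w)) ^ Mg *
            Real.exp (-(cg * (tw X w * pw X h w)))) ∧
      -- `hZp`: the sign-letter zeros on the positive side (★ p864004 §2)
      (∀ (X : skewMatrices ((IsCMField.complexConj L : L ≃ₐ[Fp L] L) : L →+* L) ((gramR L e dV hdV dW hdW).map (algebraMap (Fp L) L))) (i : φ) (w : InfinitePlace L)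
        (s : ℂ) (h : HA L e dV hdV dW hdW), sgn X w = true →
        ((∃ m : ℕ, s + 1 - k i ⟨w, IsTotallyComplex.isComplex w⟩ / 2 = -(m : ℂ)) ∨
          (∃ m : ℕ, s + 1 + k i ⟨w, IsTotallyComplex.isComplex w⟩ / 2 = -(m : ℂ) ∨ s + 1 + k i ⟨w, IsTotallyComplex.isComplex w⟩ / 2 - 1 = -(m : ℂ))) →
        Acw X i w s h = 0) ∧
      -- `hZn`: the sign-letter zeros on the negative side (★ p864004 §4)
      (∀ (X : skewMatrices ((IsCMField.complexConj L : L ≃ₐ[Fp L] L) : L →+* L) ((gramR L e dV hdV dW hdW).map (algebraMap (Fp L) L))) (i : φ) (w : InfinitePlace L)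
        (s : ℂ) (h : HA L e dV hdV dW hdW), sgn X w = false →
        ((∃ m : ℕ, s + 1 + k i ⟨w, IsTotallyComplex.isComplex w⟩ / 2 = -(m : ℂ)) ∨
          (∃ m : ℕ, s + 1 - k i ⟨w, IsTotallyComplex.isComplex w⟩ / 2 = -(m : ℂ) ∨ s + 1 - k i ⟨w, IsTotallyComplex.isComplex w⟩ / 2 - 1 = -(m : ℂ))) →
        Acw X i w s h = 0) := by
  -- the two datum-uniform letter packages, one per `K_∞`-type `k : ℤ`, chosen once (before `X`)
  choose Acp hAcp hAp hZβp hZαp hGp using fun (k' : ℤ) (hk : (k' : ℝ) / 2 < Nd) => exists_archLetters_scalarType_explicit_growth k' Nd hk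
  choose Acn hAcn hAn hZαn hZβn hGn using fun (k' : ℤ) (hk : -(k' : ℝ) / 2 < Nd) => exists_archLetters_scalarType_explicit_neg_growth k' Nd hk
  refine ⟨fun X i w s h => bif sgn X w then
      Acp (k i ⟨w, IsTotallyComplex.isComplex w⟩) (hNp i _) a (tw X w) s
        (Fr (UnitaryGroup.archPart (Fp L) L (IsCMField.complexConj L) (2 + 2) (hermD L e dV hdV dW hdW) (gc X * h)) ⟨w, IsTotallyComplex.isComplex w⟩)
    else
      Acn (k i ⟨w, IsTotallyComplex.isComplex w⟩) (hNn i _) a (tw X w) s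
        (Fr (UnitaryGroup.archPart (Fp L) L (IsCMField.complexConj L) (2 + 2) (hermD L e dV hdV dW hdW) (gc X * h)) ⟨w, IsTotallyComplex.isComplex w⟩),
    ?_, ?_, ?_, ?_, ?_, ?_⟩
  · -- `hAcw`
    intro X hX hdet h i _ w hw
    cases hb : sgn X w with
    | true =>
      simp only [hb, cond_true]
      exact hAcp _ (hNp i _) a (tw X w) ha (htw0 X hX hdet w hw) _ (hFrU _ _)
    | false =>
      simp only [hb, cond_false]
      exact hAcn _ (hNn i _) a (tw X w) ha (htw0 X hX hdet w hw) _ (hFrU _ _)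
  · -- `hAw`
    intro X hX hdet h i hi w hw s hs
    cases hb : sgn X w with
    | true =>
      simp only [hb, cond_true]
      rw [hAlocp X hX hdet h i hi w hw hb s hs]
      exact hAp _ (hNp i _) a (tw X w) ha (htw0 X hX hdet w hw) s hs _ (hFrU _ _)
    | false =>
      simp only [hb, cond_false]
      rw [hAlocn X hX hdet h i hi w hw hb s hs]
      exact hAn _ (hNn i _) a (tw X w) ha (htw0 X hX hdet w hw) s hs _ (hFrU _ _)
  · -- `hP1`
    intro X h hX hdet w hw
    have hp : 0 < pw X h w := by rw [hpw_eq]; exact gaussParam_pos ha (hFrU _ _)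
    have hR0 : 0 ≤ Rw X h w := (norm_nonneg _).trans (hRw X h w hw (Sum.inl 0) (Sum.inl 0))
    exact one_le_mul_of_one_le_of_one_le (one_le_mul_of_one_le_of_one_le (one_le_envFactor hp) (one_le_envFactor (htw0 X hX hdet w hw)))
      (le_add_of_nonneg_right hR0)
  · -- `hAcwb`: the (v) packages at every `k i w`, uniformized over the finitely many `(i, w)`
    intro z hz
    choose Mp Cp rp hCp hrp hBp using fun p : φ × InfinitePlace L => hGp (k p.1 ⟨p.2, IsTotallyComplex.isComplex p.2⟩) (hNp p.1 _) z hz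
    choose Mn Cn rn hCn hrn hBn using fun p : φ × InfinitePlace L => hGn (k p.1 ⟨p.2, IsTotallyComplex.isComplex p.2⟩) (hNn p.1 _) z hz
    have hS0 : 0 ≤ ∑ q : φ × InfinitePlace L, ((rp q)⁻¹ + (rn q)⁻¹) :=
      Finset.sum_nonneg fun q _ => add_nonneg (inv_nonneg.2 (hrp q).le) (inv_nonneg.2 (hrn q).le)
    have hCp0 : 0 ≤ ∑ q : φ × InfinitePlace L, Cp q := Finset.sum_nonneg fun q _ => hCp q
    have hCn0 : 0 ≤ ∑ q : φ × InfinitePlace L, Cn q := Finset.sum_nonneg fun q _ => hCn q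
    refine ⟨Finset.univ.sup Mp + Finset.univ.sup Mn, (∑ q : φ × InfinitePlace L, Cp q) + ∑ q : φ × InfinitePlace L, Cn q, Real.pi,
      (1 + ∑ q : φ × InfinitePlace L, ((rp q)⁻¹ + (rn q)⁻¹))⁻¹, add_nonneg hCp0 hCn0, Real.pi_pos, by positivity, ?_⟩
    intro X s hs h hX hdet i _ w hw
    have hmem : (i, w) ∈ (Finset.univ : Finset (φ × InfinitePlace L)) := Finset.mem_univ _
    have hsum1 : (rp (i, w))⁻¹ + (rn (i, w))⁻¹ ≤ 1 + ∑ q : φ × InfinitePlace L, ((rp q)⁻¹ + (rn q)⁻¹) :=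
      (Finset.single_le_sum (f := fun q => (rp q)⁻¹ + (rn q)⁻¹) (fun q _ => add_nonneg (inv_nonneg.2 (hrp q).le) (inv_nonneg.2 (hrn q).le)) hmem).trans
        (le_add_of_nonneg_left zero_le_one)
    have hsp : dist s z < rp (i, w) :=
      hs.trans_le (inv_le_of_inv_le₀ (hrp _) ((le_add_of_nonneg_right (inv_nonneg.2 (hrn _).le)).trans hsum1))
    have hsn : dist s z < rn (i, w) :=
      hs.trans_le (inv_le_of_inv_le₀ (hrn _) ((le_add_of_nonneg_left (inv_nonneg.2 (hrp _).le)).trans hsum1))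
    have ht := htw0 X hX hdet w hw
    have hp : 0 < pw X h w := by rw [hpw_eq]; exact gaussParam_pos ha (hFrU _ _)
    have hR0 : 0 ≤ Rw X h w := (norm_nonneg _).trans (hRw X h w hw (Sum.inl 0) (Sum.inl 0))
    have hSz1 : 1 ≤ ((1 + pw X h w) * (1 + (pw X h w)⁻¹)) * ((1 + tw X w) * (1 + (tw X w)⁻¹)) * (1 + Rw X h w) :=
      one_le_mul_of_one_le_of_one_le (one_le_mul_of_one_le_of_one_le (one_le_envFactor hp) (one_le_envFactor ht)) (le_add_of_nonneg_right hR0)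
    have hCpq : Cp (i, w) ≤ (∑ q : φ × InfinitePlace L, Cp q) + ∑ q : φ × InfinitePlace L, Cn q :=
      (Finset.single_le_sum (f := Cp) (fun q _ => hCp q) hmem).trans (le_add_of_nonneg_right hCn0)
    have hCnq : Cn (i, w) ≤ (∑ q : φ × InfinitePlace L, Cp q) + ∑ q : φ × InfinitePlace L, Cn q :=
      (Finset.single_le_sum (f := Cn) (fun q _ => hCn q) hmem).trans (le_add_of_nonneg_left hCp0)
    have hMp : Mp (i, w) ≤ Finset.univ.sup Mp + Finset.univ.sup Mn := (Finset.le_sup (f := Mp) hmem).trans (Nat.le_add_right _ _)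
    have hMn : Mn (i, w) ≤ Finset.univ.sup Mp + Finset.univ.sup Mn := (Finset.le_sup (f := Mn) hmem).trans (Nat.le_add_left _ _)
    cases hb : sgn X w with
    | true =>
      simp only [hb, cond_true]
      have hB := hBp (i, w) a (tw X w) ha ht _ (hFrU (UnitaryGroup.archPart (Fp L) L (IsCMField.complexConj L) (2 + 2) (hermD L e dV hdV dW hdW) (gc X * h))
        ⟨w, IsTotallyComplex.isComplex w⟩) (Rw X h w) (hRw X h w hw) s hsp
      rw [← hpw_eq X h w, mul_comm (pw X h w) (tw X w)] at hB
      exact hB.trans (mul_le_mul (mul_le_mul hCpq (pow_le_pow_right₀ hSz1 hMp) (by positivity) (add_nonneg hCp0 hCn0)) le_rfl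
        (Real.exp_pos _).le (by positivity))
    | false =>
      simp only [hb, cond_false]
      have hB := hBn (i, w) a (tw X w) ha ht _ (hFrU (UnitaryGroup.archPart (Fp L) L (IsCMField.complexConj L) (2 + 2) (hermD L e dV hdV dW hdW) (gc X * h))
        ⟨w, IsTotallyComplex.isComplex w⟩) (Rw X h w) (hRw X h w hw) s hsn
      rw [← hpw_eq X h w, mul_comm (pw X h w) (tw X w)] at hB
      exact hB.trans (mul_le_mul (mul_le_mul hCnq (pow_le_pow_right₀ hSz1 hMn) (by positivity) (add_nonneg hCp0 hCn0)) le_rfl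
        (Real.exp_pos _).le (by positivity))
  · -- `hZp`
    intro X i w s h hb hz'
    simp only [hb, cond_true]
    rcases hz' with hβ | hα
    · exact hZβp _ (hNp i _) a (tw X w) s _ hβ
    · exact hZαp _ (hNp i _) a (tw X w) s _ hα
  · -- `hZn`
    intro X i w s h hb hz'
    simp only [hb, cond_false]
    rcases hz' with hα | hβ
    · exact hZαn _ (hNn i _) a (tw X w) s _ hα
    · exact hZβn _ (hNn i _) a (tw X w) s _ hβ

/-- **ED. 2 — THE PRODUCER WITH A PER-PLACE SCALAR `sc` OUTSIDE THE INTEGRAL** (K1a desk WORD #20 (2): at the (o1) face of record, ★ p864594's `Aloc` carries the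
refined face's global scalar `γ X p s` at the distinguished place, multiplied in).  Same letters as `archLetters_of_scalarTypeGrowth`, plus BY VALUE `sc` with holomorphy
`hsc` on `{0 < re s}` and a locally uniform bound `hscb`; the readings are `Aloc = sc · ∫(±)`; OUTPUT the same six conjuncts (`Acw := sc · Acw₀`, `Cg := Cs·Cg`,
`rg := min rs rg`).  With no scalar, `sc := 1`. [cite: Shimura1982, §4 Thm. 4.2, (4.34.K)] [cite: Shimura1997, §18.4–18.5] [cite: KudlaRallis1994, §2 (2.10)–(2.12)] -/
theorem archLetters_of_scalarTypeGrowth_sc {φ : Type*} [Fintype φ]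
    (I : skewMatrices ((IsCMField.complexConj L : L ≃ₐ[Fp L] L) : L →+* L) ((gramR L e dV hdV dW hdW).map (algebraMap (Fp L) L)) → HA L e dV hdV dW hdW → Finset φ)
    (Tinf : Finset (InfinitePlace L))
    (a : Matrix (Fin 2) (Fin 2) ℂ) (ha : ‖a.det‖ = 1)
    (gc : skewMatrices ((IsCMField.complexConj L : L ≃ₐ[Fp L] L) : L →+* L) ((gramR L e dV hdV dW hdW).map (algebraMap (Fp L) L)) → HA L e dV hdV dW hdW)
    (Fr : UnitaryGroup.arch (Fp L) L (IsCMField.complexConj L) (2 + 2) (hermD L e dV hdV dW hdW) → {w : InfinitePlace L // w.IsComplex} →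
      Matrix (Fin 2 ⊕ Fin 2) (Fin 2 ⊕ Fin 2) ℂ)
    (hFrU : ∀ (x : UnitaryGroup.arch (Fp L) L (IsCMField.complexConj L) (2 + 2) (hermD L e dV hdV dW hdW)) (w : {w : InfinitePlace L // w.IsComplex}),
      (Fr x w)ᴴ * Matrix.J (Fin 2) ℂ * Fr x w = Matrix.J (Fin 2) ℂ)
    (tw : skewMatrices ((IsCMField.complexConj L : L ≃ₐ[Fp L] L) : L →+* L) ((gramR L e dV hdV dW hdW).map (algebraMap (Fp L) L)) → InfinitePlace L → ℝ)
    (htw0 : ∀ X : skewMatrices ((IsCMField.complexConj L : L ≃ₐ[Fp L] L) : L →+* L) ((gramR L e dV hdV dW hdW).map (algebraMap (Fp L) L)),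
      (X : Matrix (Fin 2) (Fin 2) L) ≠ 0 → (X : Matrix (Fin 2) (Fin 2) L).det = 0 → ∀ w' ∈ Tinf, 0 < tw X w')
    (pw Rw : skewMatrices ((IsCMField.complexConj L : L ≃ₐ[Fp L] L) : L →+* L) ((gramR L e dV hdV dW hdW).map (algebraMap (Fp L) L)) → HA L e dV hdV dW hdW →
      InfinitePlace L → ℝ)
    (hpw_eq : ∀ (X : skewMatrices ((IsCMField.complexConj L : L ≃ₐ[Fp L] L) : L →+* L) ((gramR L e dV hdV dW hdW).map (algebraMap (Fp L) L)))
      (h : HA L e dV hdV dW hdW) (w' : InfinitePlace L),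
      pw X h w' = ((aᴴ * ((2 : ℂ) • ((2 * Complex.I)⁻¹ •
        (moeb (Fr (UnitaryGroup.archPart (Fp L) L (IsCMField.complexConj L) (2 + 2) (hermD L e dV hdV dW hdW) (gc X * h)) ⟨w', IsTotallyComplex.isComplex w'⟩)
            (Complex.I • (1 : Matrix (Fin 2) (Fin 2) ℂ)) -
          (moeb (Fr (UnitaryGroup.archPart (Fp L) L (IsCMField.complexConj L) (2 + 2) (hermD L e dV hdV dW hdW) (gc X * h)) ⟨w', IsTotallyComplex.isComplex w'⟩)
            (Complex.I • (1 : Matrix (Fin 2) (Fin 2) ℂ)))ᴴ))) * a) 0 0).re)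
    (hRw : ∀ (X : skewMatrices ((IsCMField.complexConj L : L ≃ₐ[Fp L] L) : L →+* L) ((gramR L e dV hdV dW hdW).map (algebraMap (Fp L) L)))
      (h : HA L e dV hdV dW hdW), ∀ w' ∈ Tinf, ∀ i j,
      ‖Fr (UnitaryGroup.archPart (Fp L) L (IsCMField.complexConj L) (2 + 2) (hermD L e dV hdV dW hdW) (gc X * h)) ⟨w', IsTotallyComplex.isComplex w'⟩ i j‖ ≤ Rw X h w')
    (k : φ → {w : InfinitePlace L // w.IsComplex} → ℤ) (Nd : ℕ)
    (hNp : ∀ i w, (k i w : ℝ) / 2 < Nd) (hNn : ∀ i w, -(k i w : ℝ) / 2 < Nd)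
    (sgn : skewMatrices ((IsCMField.complexConj L : L ≃ₐ[Fp L] L) : L →+* L) ((gramR L e dV hdV dW hdW).map (algebraMap (Fp L) L)) → InfinitePlace L → Bool)
    (sc : skewMatrices ((IsCMField.complexConj L : L ≃ₐ[Fp L] L) : L →+* L) ((gramR L e dV hdV dW hdW).map (algebraMap (Fp L) L)) → φ → InfinitePlace L → ℂ → ℂ)
    (hsc : ∀ (X : skewMatrices ((IsCMField.complexConj L : L ≃ₐ[Fp L] L) : L →+* L) ((gramR L e dV hdV dW hdW).map (algebraMap (Fp L) L))) (i : φ)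
      (w' : InfinitePlace L), DifferentiableOn ℂ (sc X i w') {s : ℂ | 0 < s.re})
    (hscb : ∀ z : ℂ, 0 < z.re → ∃ (Cs rs : ℝ), 0 ≤ Cs ∧ 0 < rs ∧
      ∀ X : skewMatrices ((IsCMField.complexConj L : L ≃ₐ[Fp L] L) : L →+* L) ((gramR L e dV hdV dW hdW).map (algebraMap (Fp L) L)),
      (X : Matrix (Fin 2) (Fin 2) L) ≠ 0 → (X : Matrix (Fin 2) (Fin 2) L).det = 0 → ∀ (h : HA L e dV hdV dW hdW), ∀ i ∈ I X h, ∀ w' ∈ Tinf,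
      ∀ s : ℂ, dist s z < rs → ‖sc X i w' s‖ ≤ Cs)
    (Aloc : skewMatrices ((IsCMField.complexConj L : L ≃ₐ[Fp L] L) : L →+* L) ((gramR L e dV hdV dW hdW).map (algebraMap (Fp L) L)) → φ → InfinitePlace L → ℂ →
      HA L e dV hdV dW hdW → ℂ)
    (hAlocp : ∀ X : skewMatrices ((IsCMField.complexConj L : L ≃ₐ[Fp L] L) : L →+* L) ((gramR L e dV hdV dW hdW).map (algebraMap (Fp L) L)),
      (X : Matrix (Fin 2) (Fin 2) L) ≠ 0 → (X : Matrix (Fin 2) (Fin 2) L).det = 0 → ∀ (h : HA L e dV hdV dW hdW), ∀ i ∈ I X h, ∀ w' ∈ Tinf, sgn X w' = true →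
      ∀ s : ℂ, 1 / 2 < s.re → Aloc X i w' s h = sc X i w' s *
        ∫ r : Fin 2 → Fin 2 → ℝ, cexp (-(2 * Real.pi * Complex.I) * ((a * hermTwo (tw X w', 0, 0) * aᴴ) * hermOfReal r).trace) *
          archScalarSection (k i ⟨w', IsTotallyComplex.isComplex w'⟩) s (Matrix.J (Fin 2) ℂ * fromBlocks 1 (hermOfReal r) 0 1 *
            Fr (UnitaryGroup.archPart (Fp L) L (IsCMField.complexConj L) (2 + 2) (hermD L e dV hdV dW hdW) (gc X * h)) ⟨w', IsTotallyComplex.isComplex w'⟩))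
    (hAlocn : ∀ X : skewMatrices ((IsCMField.complexConj L : L ≃ₐ[Fp L] L) : L →+* L) ((gramR L e dV hdV dW hdW).map (algebraMap (Fp L) L)),
      (X : Matrix (Fin 2) (Fin 2) L) ≠ 0 → (X : Matrix (Fin 2) (Fin 2) L).det = 0 → ∀ (h : HA L e dV hdV dW hdW), ∀ i ∈ I X h, ∀ w' ∈ Tinf, sgn X w' = false →
      ∀ s : ℂ, 1 / 2 < s.re → Aloc X i w' s h = sc X i w' s *
        ∫ r : Fin 2 → Fin 2 → ℝ, cexp (-(2 * Real.pi * Complex.I) * ((-(a * hermTwo (tw X w', 0, 0) * aᴴ)) * hermOfReal r).trace) *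
          archScalarSection (k i ⟨w', IsTotallyComplex.isComplex w'⟩) s (Matrix.J (Fin 2) ℂ * fromBlocks 1 (hermOfReal r) 0 1 *
            Fr (UnitaryGroup.archPart (Fp L) L (IsCMField.complexConj L) (2 + 2) (hermD L e dV hdV dW hdW) (gc X * h)) ⟨w', IsTotallyComplex.isComplex w'⟩)) :
    ∃ Acw : skewMatrices ((IsCMField.complexConj L : L ≃ₐ[Fp L] L) : L →+* L) ((gramR L e dV hdV dW hdW).map (algebraMap (Fp L) L)) → φ → InfinitePlace L → ℂ →
        HA L e dV hdV dW hdW → ℂ,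
      -- `hAcw` (★ p864498 :91–:93)
      (∀ X : skewMatrices ((IsCMField.complexConj L : L ≃ₐ[Fp L] L) : L →+* L) ((gramR L e dV hdV dW hdW).map (algebraMap (Fp L) L)),
        (X : Matrix (Fin 2) (Fin 2) L) ≠ 0 → (X : Matrix (Fin 2) (Fin 2) L).det = 0 → ∀ (h : HA L e dV hdV dW hdW), ∀ i ∈ I X h, ∀ w ∈ Tinf,
          DifferentiableOn ℂ (fun s => Acw X i w s h) {s : ℂ | 0 < s.re}) ∧
      -- `hAw` (★ p864498 :94–:96)
      (∀ X : skewMatrices ((IsCMField.complexConj L : L ≃ₐ[Fp L] L) : L →+* L) ((gramR L e dV hdV dW hdW).map (algebraMap (Fp L) L)),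
        (X : Matrix (Fin 2) (Fin 2) L) ≠ 0 → (X : Matrix (Fin 2) (Fin 2) L).det = 0 → ∀ (h : HA L e dV hdV dW hdW), ∀ i ∈ I X h, ∀ w ∈ Tinf,
          ∀ s : ℂ, 1 / 2 < s.re → Aloc X i w s h = Acw X i w s h) ∧
      -- `hP1` (★ p864498 :114–:115) at the booked `Pw`
      (∀ (X : skewMatrices ((IsCMField.complexConj L : L ≃ₐ[Fp L] L) : L →+* L) ((gramR L e dV hdV dW hdW).map (algebraMap (Fp L) L))) (h : HA L e dV hdV dW hdW),
        (X : Matrix (Fin 2) (Fin 2) L) ≠ 0 → (X : Matrix (Fin 2) (Fin 2) L).det = 0 → ∀ w ∈ Tinf,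
          1 ≤ ((1 + pw X h w) * (1 + (pw X h w)⁻¹)) * ((1 + tw X w) * (1 + (tw X w)⁻¹)) * (1 + Rw X h w)) ∧
      -- `hAcwb` (★ p864498 :116–:119) at the booked `Pw`, `gw := tw·pw`
      (∀ z : ℂ, 0 < z.re → ∃ (Mg : ℕ) (Cg cg rg : ℝ), 0 ≤ Cg ∧ 0 < cg ∧ 0 < rg ∧
        ∀ (X : skewMatrices ((IsCMField.complexConj L : L ≃ₐ[Fp L] L) : L →+* L) ((gramR L e dV hdV dW hdW).map (algebraMap (Fp L) L))) (s : ℂ), dist s z < rg →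
        ∀ h : HA L e dV hdV dW hdW, (X : Matrix (Fin 2) (Fin 2) L) ≠ 0 → (X : Matrix (Fin 2) (Fin 2) L).det = 0 → ∀ i ∈ I X h, ∀ w ∈ Tinf,
          ‖Acw X i w s h‖ ≤ Cg * (((1 + pw X h w) * (1 + (pw X h w)⁻¹)) * ((1 + tw X w) * (1 + (tw X w)⁻¹)) * (1 + Rw X h w)) ^ Mg *
            Real.exp (-(cg * (tw X w * pw X h w)))) ∧
      -- `hZp`: the sign-letter zeros on the positive side (★ p864004 §2)
      (∀ (X : skewMatrices ((IsCMField.complexConj L : L ≃ₐ[Fp L] L) : L →+* L) ((gramR L e dV hdV dW hdW).map (algebraMap (Fp L) L))) (i : φ) (w : InfinitePlace L)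
        (s : ℂ) (h : HA L e dV hdV dW hdW), sgn X w = true →
        ((∃ m : ℕ, s + 1 - k i ⟨w, IsTotallyComplex.isComplex w⟩ / 2 = -(m : ℂ)) ∨
          (∃ m : ℕ, s + 1 + k i ⟨w, IsTotallyComplex.isComplex w⟩ / 2 = -(m : ℂ) ∨ s + 1 + k i ⟨w, IsTotallyComplex.isComplex w⟩ / 2 - 1 = -(m : ℂ))) →
        Acw X i w s h = 0) ∧
      -- `hZn`: the sign-letter zeros on the negative side (★ p864004 §4)
      (∀ (X : skewMatrices ((IsCMField.complexConj L : L ≃ₐ[Fp L] L) : L →+* L) ((gramR L e dV hdV dW hdW).map (algebraMap (Fp L) L))) (i : φ) (w : InfinitePlace L)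
        (s : ℂ) (h : HA L e dV hdV dW hdW), sgn X w = false →
        ((∃ m : ℕ, s + 1 + k i ⟨w, IsTotallyComplex.isComplex w⟩ / 2 = -(m : ℂ)) ∨
          (∃ m : ℕ, s + 1 - k i ⟨w, IsTotallyComplex.isComplex w⟩ / 2 = -(m : ℂ) ∨ s + 1 - k i ⟨w, IsTotallyComplex.isComplex w⟩ / 2 - 1 = -(m : ℂ))) →
        Acw X i w s h = 0) := by
  -- ED. 1 at the bare sign-split integrals
  obtain ⟨Acw₀, hAcw₀, hAw₀, hP1₀, hAcwb₀, hZp₀, hZn₀⟩ := archLetters_of_scalarTypeGrowth L e dV hdV dW hdW I Tinf a ha gc Fr hFrU tw htw0 pw Rw hpw_eq hRw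
    k Nd hNp hNn sgn
    (fun X i w' s h => bif sgn X w' then
        ∫ r : Fin 2 → Fin 2 → ℝ, cexp (-(2 * Real.pi * Complex.I) * ((a * hermTwo (tw X w', 0, 0) * aᴴ) * hermOfReal r).trace) *
                  archScalarSection (k i ⟨w', IsTotallyComplex.isComplex w'⟩) s (Matrix.J (Fin 2) ℂ * fromBlocks 1 (hermOfReal r) 0 1 *
                    Fr (UnitaryGroup.archPart (Fp L) L (IsCMField.complexConj L) (2 + 2) (hermD L e dV hdV dW hdW) (gc X * h)) ⟨w', IsTotallyComplex.isComplex w'⟩)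
      else
        ∫ r : Fin 2 → Fin 2 → ℝ, cexp (-(2 * Real.pi * Complex.I) * ((-(a * hermTwo (tw X w', 0, 0) * aᴴ)) * hermOfReal r).trace) *
                  archScalarSection (k i ⟨w', IsTotallyComplex.isComplex w'⟩) s (Matrix.J (Fin 2) ℂ * fromBlocks 1 (hermOfReal r) 0 1 *
                    Fr (UnitaryGroup.archPart (Fp L) L (IsCMField.complexConj L) (2 + 2) (hermD L e dV hdV dW hdW) (gc X * h)) ⟨w', IsTotallyComplex.isComplex w'⟩))
    (fun X _ _ h i _ w' _ hb s _ => by simp only [hb, cond_true]) (fun X _ _ h i _ w' _ hb s _ => by simp only [hb, cond_false])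
  refine ⟨fun X i w s h => sc X i w s * Acw₀ X i w s h, fun X hX hdet h i hi w hw => (hsc X i w).mul (hAcw₀ X hX hdet h i hi w hw),
    fun X hX hdet h i hi w hw s hs => ?_, hP1₀, fun z hz => ?_, fun X i w s h hb hz' => mul_eq_zero_of_right _ (hZp₀ X i w s h hb hz'),
    fun X i w s h hb hz' => mul_eq_zero_of_right _ (hZn₀ X i w s h hb hz')⟩
  · -- `hAw`
    have h0 := hAw₀ X hX hdet h i hi w hw s hs
    cases hb : sgn X w with
    | true =>
      simp only [hb, cond_true] at h0
      rw [hAlocp X hX hdet h i hi w hw hb s hs, h0]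
    | false =>
      simp only [hb, cond_false] at h0
      rw [hAlocn X hX hdet h i hi w hw hb s hs, h0]
  · -- `hAcwb`
    obtain ⟨Mg, Cg, cg, rg, hCg, hcg, hrg, hB⟩ := hAcwb₀ z hz
    obtain ⟨Cs, rs, hCs, hrs, hS⟩ := hscb z hz
    refine ⟨Mg, Cs * Cg, cg, min rs rg, mul_nonneg hCs hCg, hcg, lt_min hrs hrg, fun X s hs h hX hdet i hi w hw => ?_⟩
    rw [norm_mul]
    calc ‖sc X i w s‖ * ‖Acw₀ X i w s h‖
        ≤ Cs * (Cg * (((1 + pw X h w) * (1 + (pw X h w)⁻¹)) * ((1 + tw X w) * (1 + (tw X w)⁻¹)) * (1 + Rw X h w)) ^ Mg *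
            Real.exp (-(cg * (tw X w * pw X h w)))) :=
          mul_le_mul (hS X hX hdet h i hi w hw s (hs.trans_le (min_le_left _ _))) (hB X s (hs.trans_le (min_le_right _ _)) h hX hdet i hi w hw)
            (norm_nonneg _) hCs
      _ = Cs * Cg * (((1 + pw X h w) * (1 + (pw X h w)⁻¹)) * ((1 + tw X w) * (1 + (tw X w)⁻¹)) * (1 + Rw X h w)) ^ Mg *
            Real.exp (-(cg * (tw X w * pw X h w))) := by ring

end Summit.HodgeConjecture.HodgeConjecture.Cruxes.HLiu418.K2LiuKindOneSingularArchLettersOfRecord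

end
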